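import Summits.AnomalousDissipation.AnomalousDissipation.Theorems.GalerkinInvariantLoud.Negative.Clauses
import Summits.AnomalousDissipation.AnomalousDissipation.Theorems.CubicParityLoud.Negative.MeanFlow

/-!
# Negative knowledge for the crux `MomentParity.GalerkinInvariantLoud` (stmt-AnomalousDissipation-14283), V:
# the onset viscosity is load-bearing (mean-flow floor, laminar ceiling, no `∀ν` version)

Certified copy of §2d of the cdisprove work file `Cruxes/GalerkinInvariantLoud/Disproof.lean`
(refuter-cdisprove-stmt-AnomalousDissipation-14283-0, cycle 1). Supports stmt-AnomalousDissipation-14283; no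
conclusion asserts a Theses decl positively. Reuses the sibling crux's mean-flow file
(`Theorems/CubicParityLoud/Negative/MeanFlow.lean`, refuter-cdisprove-stmt-AnomalousDissipation-11465-0).

* `IsGILWitness.isWitness3` — a witness of this crux is a `CubicParityLoud` witness.
* `IsGILWitness.eps_le_meanFlow` (`ε ≤ ‖f‖₂‖ū_N‖₂`), `IsGILWitness.laminar` (`ε ≤ ‖f‖₂²/(4π²ν)`).
* `not_gilEveryViscosity` — `∃ f E ε ∀ (ν_j → 0) ∀ j …` is FALSE (first terms above the laminar threshold).
-/

namespace Summit.AnomalousDissipation.AnomalousDissipation.Theorems.GalerkinInvariantLoud.Negative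

open MeasureTheory Filter Topology
open scoped ENNReal InnerProductSpace RealInnerProductSpace
open Literature.Analysis.FunctionSpaces Literature.Analysis.FluidPDE
open Summit.AnomalousDissipation.AnomalousDissipation.Theses.MomentParity
open Summit.AnomalousDissipation.AnomalousDissipation.Theorems
open Summit.AnomalousDissipation.AnomalousDissipation.Theorems.QuarticGate.Negative

noncomputable section

open Summit.AnomalousDissipation.AnomalousDissipation.Theorems.CubicParityLoud.Negative (T3 R3 H3 L2T3)

/-! ### §2d The onset viscosity is load-bearing: mean-flow floor, laminar ceiling, no `∀ν` version

Transfer to the sibling crux's witness notion (`CubicParityLoud.Negative.IsWitness`: 3-stationary, finite third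
moments) and its mean-flow file: every witness carries a MACROSCOPIC level-`N` mean flow `‖ū_N‖₂ ≥ ε/‖f‖₂`, and
obeys the LAMINAR CEILING `ε ≤ ‖f‖₂²/(4π²ν)`. Hence the strengthening in which the viscosity sequence is quantified
UNIVERSALLY (`∃ f E ε ∀ ν_j → 0 ∀ j …`) is FALSE: its first terms may exceed the laminar threshold `‖f‖₂²/(4π²ε)`. -/

section Viscosity

/-- A witness of this crux is a witness of `CubicParityLoud` at the same `(f, ν, N, E, ε)`. -/
theorem IsGILWitness.isWitness3 {f : T3 → R3} {ν : ℝ} {N : ℕ} {R E ε : ℝ} {μ : Measure H3}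
    (h : IsGILWitness f ν N R E ε μ) : CubicParityLoud.Negative.IsWitness f ν N E ε μ := by
  obtain ⟨hp, hl, hR, hinv, hE, hε⟩ := h
  exact ⟨hp, hl, integrable_norm_pow_of_ae_le hR 3, fun m g P hg hP => hinv m g P hg, hE, hε⟩

/-- **MEAN-FLOW FLOOR**: `ε ≤ ‖f‖₂ ‖ū_N‖₂` — loudness is the work of the level-`N` mean flow
`ū_N = Σᵢ (∫(u,eᵢ)dμ) eᵢ` (sibling `CubicParityLoud/Negative/MeanFlow.lean`). -/
theorem IsGILWitness.eps_le_meanFlow {f : T3 → R3} (hf : MemLp f 2 volume) {ν : ℝ} {N : ℕ} {R E ε : ℝ}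
    {μ : Measure H3} (h : IsGILWitness f ν N R E ε μ) :
    ε ≤ Real.sqrt (∫ x, ‖f x‖ ^ 2) * Real.sqrt (∫ x, ‖CubicParityLoud.Negative.meanFlow N μ x‖ ^ 2) :=
  h.isWitness3.le_meanFlow hf

/-- **LAMINAR CEILING**: `ε ≤ ‖f‖₂²/(4π²ν)` — witnesses exist only below the laminar threshold
`ν ≤ ‖f‖₂²/(4π²ε)`. -/
theorem IsGILWitness.laminar {f : T3 → R3} (hf : MemLp f 2 volume) {ν : ℝ} (hν : 0 < ν) {N : ℕ} {R E ε : ℝ}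
    (hε : 0 < ε) {μ : Measure H3} (h : IsGILWitness f ν N R E ε μ) :
    ε ≤ (∫ x, ‖f x‖ ^ 2) / (4 * Real.pi ^ 2 * ν) :=
  h.isWitness3.laminar hf hν hε

/-- STRENGTHENING 5 (refuted): the viscosity sequence quantified universally. -/
def GILEveryViscosity : Prop :=
  ∃ f : T3 → R3, Torus.IsSmooth f ∧ Torus.IsDivFree f ∧ Torus.HasZeroMean f ∧
    ∃ (E ε : ℝ), 0 < ε ∧ ∀ ν : ℕ → ℝ, (∀ j, 0 < ν j) → Tendsto ν atTop (𝓝 0) →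
    ∀ j : ℕ, ∃ R : ℝ, ∃ᶠ N in atTop, ∃ μ, IsGILWitness f (ν j) N R E ε μ

/-- **`¬ GILEveryViscosity`**: along `ν_j = K/(j+1)` with `K = ‖f‖₂²/(4π²ε) + 1` there is no witness at `j = 0`
(laminar ceiling). The `∃ ν` of the crux is load-bearing through its ONSET: any proof must start below
`‖f‖₂²/(4π²ε)`. -/
theorem not_gilEveryViscosity : ¬ GILEveryViscosity := by
  rintro ⟨f, hfs, -, -, E, ε, hε, h⟩
  have hpi : 0 < Real.pi := Real.pi_pos
  set F2 : ℝ := ∫ x, ‖f x‖ ^ 2 with hF2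
  have hF0 : 0 ≤ F2 := integral_nonneg fun x => by positivity
  set K : ℝ := F2 / (4 * Real.pi ^ 2 * ε) + 1 with hK
  have hK0 : 0 < K := by positivity
  have hν := h (fun j => K / ((j : ℝ) + 1)) (fun j => by positivity)
    ((tendsto_const_nhds.div_atTop (tendsto_natCast_atTop_atTop.atTop_add tendsto_const_nhds)))
  obtain ⟨R, hR⟩ := hν 0
  obtain ⟨N, μ, hμ⟩ := hR.exists
  have hlam := hμ.laminar (hfs.memLp 2) (by positivity) hε
  simp only [Nat.cast_zero, zero_add, div_one] at hlam
  -- `ε ≤ F2/(4π²K)` with `K > F2/(4π²ε)` is absurd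
  rw [le_div_iff₀ (by positivity)] at hlam
  have : ε * (4 * Real.pi ^ 2 * K) = F2 + ε * (4 * Real.pi ^ 2) := by
    rw [hK]; field_simp
  linarith [mul_pos hε (by positivity : (0 : ℝ) < 4 * Real.pi ^ 2)]

end Viscosity

end

end Summit.AnomalousDissipation.AnomalousDissipation.Theorems.GalerkinInvariantLoud.Negative
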